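import Mathlib.Algebra.MvPolynomial.Equiv
import Mathlib.Algebra.MvPolynomial.Rename
import Mathlib.RingTheory.Polynomial.UniqueFactorization
import Mathlib.RingTheory.UniqueFactorizationDomain.Basic
import HarnessLib

/-!
# Linear (simple) reducibility of a finite set of polynomials (Brown 2009, §4.1)

Topic `Literature/NumberTheory/Transcendental`; definition item `defn-LinearlyReducible` (route
KontsevichZagierPeriods/LinRedNormalForm; envelope of the typed cores `DihedralNormalForm`,
`ArrangementNormalForm`).

Source read: F. Brown, *The massless higher-loop two-point function*, Comm. Math. Phys. 287 (2009)
925–958 = arXiv:0804.1660 (`Brown2009`), §4.1 "The simple reduction algorithm" (arXiv p. 10),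
verbatim: "Let `S = {f_1, …, f_N}`, where `f_1, …, f_N` are polynomials in the variables
`α_1, …, α_m`, with rational coefficients. Suppose that there exists an index `1 ≤ r ≤ m` with respect
to which every polynomial `f_1, …, f_N` is linear in the variable `α_r`. Then we can write
`f_i = g_i α_r + h_i`, where `g_i = ∂f_i/∂α_r`, and `h_i = f_i|_{α_r=0}`. Define a new set of
polynomials `S̃_(r) = {(g_i), (h_i), (h_i g_j − g_i h_j)_{i<j}}`. Let `S_(r)` be the set of irreducible
factors of polynomials in `S̃_(r)`. The polynomials now occurring in `S_(r)` are functions of one fewer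
variables … This process can be repeated. If at each stage there exists a variable in which all
polynomials are linear, we can proceed to the next stage … If there exists a sequence `(r_1, …, r_m)`
such that every variable is eventually eliminated, then we say that the reduction terminates. When
this happens, we say that the set `S` is simply reducible." Remark 9: "We can remove any constants, and
any monomials of the form `α_i` which occur as elements in `S_(r)`, as this does not affect the outcome
of the algorithm." (§4.2, Def. 13, refines this to FUBINI reducibility by intersecting the sets obtained
from different orders; later literature — Brown arXiv:0910.0114, Panzer, Comput. Phys. Commun. 188
(2015) and thesis arXiv:1506.07243 Ch. 3 — calls these notions (simple / Fubini / compatibility-graph)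
LINEAR REDUCIBILITY.)

## What is formalised (the SIMPLE version, for a prescribed order, then `∃` order)

For a field `K` (Brown: `ℚ`) and polynomials in `MvPolynomial (Fin n) K`:

* `linCoeff P`, `constCoeff₀ P` — writing `P = g·x₀ + h + (higher powers of x₀)` through Mathlib's
  `MvPolynomial.finSuccEquiv` (which singles out the variable `0`): `g = [P]₁`, `h = [P]₀ = P|_{x₀=0}`;
  `IsLinearInZero P` — `P` has degree `≤ 1` in `x₀` (`natDegree ≤ 1` after `finSuccEquiv`).
* `brownReductionTilde S = S̃_(0) = {g_P, h_P : P ∈ S} ∪ {h_P g_Q − g_P h_Q : P, Q ∈ S}` (all ordered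
  pairs; the extra `P = Q` terms vanish and the sign is immaterial for irreducible factors) and
  `brownReduction S = S_(0)`: the set of irreducible factors of the NON-ZERO members of `S̃_(0)` (units,
  i.e. non-zero constants, have no irreducible factors, matching Remark 9; the factors are Mathlib's
  `UniqueFactorizationMonoid.factors`, a choice of representatives up to units — the notions below are
  insensitive to rescaling members of the sets by units).
* `IsLinearlyReducibleSeq n S` — by recursion on `n`: every member of `S` is linear in `x₀`, and
  `brownReduction S` (polynomials in `x₁, …` reindexed as `Fin (n-1)`) is again linearly reducible;
  vacuous in `0` variables. This is simple reducibility for the elimination order `x₀, x₁, …, x_{n-1}`.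
* `IsLinearlyReducibleFor S σ` — for the order `x_{σ 0}, x_{σ 1}, …` (rename `x_{σ k} ↦ x_k`, then the
  above); `IsLinearlyReducible S = ∃ σ, IsLinearlyReducibleFor S σ` — Brown's "simply reducible".

NOT formalised here: the Fubini (Def. 13) and compatibility-graph (Panzer) refinements, Remark 9's
removal of monomials `α_i` (they are kept; harmless: linear in every variable, and they only add linear
forms downstream), the reducibility of INTEGRANDS (`KZ.IntegralRep`), and Brown's theorem that linear
reducibility makes the iterated integrals hyperlogarithms / MZVs.

Proved API: unfolding lemmas, the empty set and every set in `0` variables are reducible, reduction is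
monotone and reducibility descends to subsets (`IsLinearlyReducibleSeq.mono`), and the one-variable
sanity example `{x, 1 − x}` (the singularities `{0, 1}` of the simplex/cube coordinate) is linearly
reducible.
-/

noncomputable section

open scoped Classical
open MvPolynomial Polynomial

namespace Literature.NumberTheory.Transcendental

namespace LinearReduction

variable {K : Type*} [Field K] {n : ℕ}

/-- The coefficient `g = [P]₁ = ∂P/∂x₀` of `x₀` in `P`, a polynomial in the remaining variables
(`x_{j+1} ↦ x_j`): the degree-`1` coefficient of `finSuccEquiv K n P ∈ (K[x₁,…])[x₀]` ("`g_i = ∂f_i/∂α_r`"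
when `f_i` is linear in `α_r`). [cite: Brown2009, §4.1] -/
def linCoeff (P : MvPolynomial (Fin (n + 1)) K) : MvPolynomial (Fin n) K :=
  (finSuccEquiv K n P).coeff 1

/-- The constant term `h = [P]₀ = P|_{x₀ = 0}` of `P` in `x₀` ("`h_i = f_i|_{α_r=0}`").
[cite: Brown2009, §4.1] -/
def constCoeff₀ (P : MvPolynomial (Fin (n + 1)) K) : MvPolynomial (Fin n) K :=
  (finSuccEquiv K n P).coeff 0

/-- `P` is **linear in `x₀`**: of degree `≤ 1` as a polynomial in `x₀` ("every polynomial `f_1, …, f_N`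
is linear in the variable `α_r`"; degree `0`, i.e. independence of `α_r`, is allowed, as in the
source's iterations). [cite: Brown2009, §4.1] -/
def IsLinearInZero (P : MvPolynomial (Fin (n + 1)) K) : Prop :=
  (finSuccEquiv K n P).natDegree ≤ 1

/-- **Brown's set `S̃_(r)`** for the variable `r = x₀`: the coefficients `g_P`, `h_P` of all `P ∈ S` and
the resultants `h_P g_Q − g_P h_Q` of all pairs ("`S̃_(r) = {(g_i), (h_i), (h_i g_j − g_i h_j)_{i<j}}`";
all ordered pairs are taken, which only adds `0` and sign changes). [cite: Brown2009, §4.1] -/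
def brownReductionTilde (S : Finset (MvPolynomial (Fin (n + 1)) K)) : Finset (MvPolynomial (Fin n) K) :=
  S.image linCoeff ∪ S.image constCoeff₀ ∪
    (S ×ˢ S).image fun PQ => constCoeff₀ PQ.1 * linCoeff PQ.2 - linCoeff PQ.1 * constCoeff₀ PQ.2

/-- **Brown's reduced set `S_(r)`** for `r = x₀`: "the set of irreducible factors of polynomials in
`S̃_(r)`" — the irreducible factors (Mathlib's `UniqueFactorizationMonoid.factors`, representatives up
to units) of the non-zero members of `brownReductionTilde S`; non-zero constants contribute nothing
(Remark 9: constants can be removed). [cite: Brown2009, §4.1 (with Remark 9)] -/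
def brownReduction (S : Finset (MvPolynomial (Fin (n + 1)) K)) : Finset (MvPolynomial (Fin n) K) :=
  ((brownReductionTilde S).filter (· ≠ 0)).biUnion fun f => (UniqueFactorizationMonoid.factors f).toFinset

/-- **Simple (linear) reducibility for the elimination order `x₀, x₁, …, x_{n-1}`**, by recursion on
the number of variables: every member of `S` is linear in `x₀` and the reduced set `S_(x₀)`, a set of
polynomials in one fewer variables, is again reducible; in `0` variables there is nothing to eliminate
("If at each stage there exists a variable in which all polynomials are linear, we can proceed to the
next stage … every variable is eventually eliminated"). [cite: Brown2009, §4.1] -/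
def IsLinearlyReducibleSeq : (n : ℕ) → Finset (MvPolynomial (Fin n) K) → Prop
  | 0, _ => True
  | n + 1, S => (∀ P ∈ S, IsLinearInZero P) ∧ IsLinearlyReducibleSeq n (brownReduction S)

end LinearReduction

open LinearReduction

variable {K : Type*} [Field K] {n : ℕ}

/-- **`S` is simply (linearly) reducible for the order `σ`**: eliminating the variables in the order
`x_{σ 0}, x_{σ 1}, …, x_{σ (n-1)}` — i.e. after renaming `x_{σ k} ↦ x_k` — the simple reduction
algorithm of Brown runs to the end (`IsLinearlyReducibleSeq`). [cite: Brown2009, §4.1] -/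
def IsLinearlyReducibleFor (S : Finset (MvPolynomial (Fin n) K)) (σ : Equiv.Perm (Fin n)) : Prop :=
  IsLinearlyReducibleSeq n (S.image (rename σ.symm))

/-- **`S` is simply reducible** (Brown 2009, §4.1; "linearly reducible" in the simple sense of the
later literature): for SOME order of the variables the simple reduction algorithm eliminates every
variable ("If there exists a sequence `(r_1, …, r_m)` such that every variable is eventually
eliminated … we say that the set `S` is simply reducible"). [cite: Brown2009, §4.1] -/
def IsLinearlyReducible (S : Finset (MvPolynomial (Fin n) K)) : Prop :=
  ∃ σ : Equiv.Perm (Fin n), IsLinearlyReducibleFor S σ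

/-! ### API -/

namespace LinearReduction

/-- Unfolding in positive dimension. [cite: Brown2009, §4.1] -/
theorem isLinearlyReducibleSeq_succ (S : Finset (MvPolynomial (Fin (n + 1)) K)) :
    IsLinearlyReducibleSeq (n + 1) S ↔
      (∀ P ∈ S, IsLinearInZero P) ∧ IsLinearlyReducibleSeq n (brownReduction S) :=
  Iff.rfl

/-- In `0` variables every set is reducible (nothing to eliminate). [cite: Brown2009, §4.1] -/
@[simp] theorem isLinearlyReducibleSeq_zero (S : Finset (MvPolynomial (Fin 0) K)) :
    IsLinearlyReducibleSeq 0 S :=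
  trivial

/-- The `S̃`-construction is monotone. [folklore] -/
theorem brownReductionTilde_mono {S T : Finset (MvPolynomial (Fin (n + 1)) K)} (h : S ⊆ T) :
    brownReductionTilde S ⊆ brownReductionTilde T := by
  unfold brownReductionTilde
  exact Finset.union_subset_union
    (Finset.union_subset_union (Finset.image_subset_image h) (Finset.image_subset_image h))
    (Finset.image_subset_image (Finset.product_subset_product h h))

/-- The reduction is monotone. [folklore] -/
theorem brownReduction_mono {S T : Finset (MvPolynomial (Fin (n + 1)) K)} (h : S ⊆ T) :
    brownReduction S ⊆ brownReduction T := by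
  unfold brownReduction
  exact Finset.biUnion_subset_biUnion_of_subset_left _
    (Finset.filter_subset_filter _ (brownReductionTilde_mono h))

/-- The reduction of the empty set is empty. [folklore] -/
@[simp] theorem brownReductionTilde_empty :
    brownReductionTilde (∅ : Finset (MvPolynomial (Fin (n + 1)) K)) = ∅ := by
  simp [brownReductionTilde]

/-- The reduction of the empty set is empty. [folklore] -/
@[simp] theorem brownReduction_empty :
    brownReduction (∅ : Finset (MvPolynomial (Fin (n + 1)) K)) = ∅ := by
  simp [brownReduction]

/-- **Reducibility descends to subsets** (fewer polynomials, smaller cascades).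
[cite: Brown2009, §4.2 Remark 14 (inclusions of cascades)] -/
theorem IsLinearlyReducibleSeq.mono :
    ∀ {n : ℕ} {S T : Finset (MvPolynomial (Fin n) K)}, S ⊆ T →
      IsLinearlyReducibleSeq n T → IsLinearlyReducibleSeq n S
  | 0, _, _, _, _ => trivial
  | _ + 1, _, _, hST, ⟨hlin, hred⟩ =>
    ⟨fun P hP => hlin P (hST hP), IsLinearlyReducibleSeq.mono (brownReduction_mono hST) hred⟩

/-- The empty set of polynomials is reducible in every number of variables. [folklore] -/
theorem isLinearlyReducibleSeq_empty : ∀ n : ℕ, IsLinearlyReducibleSeq n (∅ : Finset (MvPolynomial (Fin n) K))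
  | 0 => trivial
  | n + 1 => ⟨fun P hP => absurd hP (Finset.notMem_empty P), by
      rw [brownReduction_empty]; exact isLinearlyReducibleSeq_empty n⟩

/-- The variable `x₀` is linear in `x₀`. [folklore] -/
theorem isLinearInZero_X_zero : IsLinearInZero (X 0 : MvPolynomial (Fin (n + 1)) K) := by
  unfold IsLinearInZero
  rw [finSuccEquiv_X_zero]
  exact natDegree_X_le

/-- `1 − x₀` is linear in `x₀`. [folklore] -/
theorem isLinearInZero_one_sub_X_zero : IsLinearInZero (1 - X 0 : MvPolynomial (Fin (n + 1)) K) := by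
  unfold IsLinearInZero
  rw [map_sub, map_one, finSuccEquiv_X_zero]
  refine (natDegree_sub_le _ _).trans ?_
  simp

end LinearReduction

/-- The empty set is linearly reducible for every order. [folklore] -/
theorem isLinearlyReducibleFor_empty (σ : Equiv.Perm (Fin n)) :
    IsLinearlyReducibleFor (∅ : Finset (MvPolynomial (Fin n) K)) σ := by
  simp only [IsLinearlyReducibleFor, Finset.image_empty]
  exact LinearReduction.isLinearlyReducibleSeq_empty n

/-- Reducibility for an order descends to subsets. [cite: Brown2009, §4.2 Remark 14] -/
theorem IsLinearlyReducibleFor.mono {S T : Finset (MvPolynomial (Fin n) K)} (hST : S ⊆ T)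
    {σ : Equiv.Perm (Fin n)} (h : IsLinearlyReducibleFor T σ) : IsLinearlyReducibleFor S σ :=
  LinearReduction.IsLinearlyReducibleSeq.mono (Finset.image_subset_image hST) h

/-- Linear reducibility descends to subsets. [cite: Brown2009, §4.2 Remark 14] -/
theorem IsLinearlyReducible.mono {S T : Finset (MvPolynomial (Fin n) K)} (hST : S ⊆ T)
    (h : IsLinearlyReducible T) : IsLinearlyReducible S := by
  obtain ⟨σ, hσ⟩ := h
  exact ⟨σ, hσ.mono hST⟩

/-- **Sanity example (one variable):** `{x, 1 − x} ⊂ K[x]` — the singular divisors `x = 0, 1` of the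
coordinate of the unit interval — is linearly reducible. [folklore] -/
theorem isLinearlyReducible_X_oneSubX :
    IsLinearlyReducible ({X 0, 1 - X 0} : Finset (MvPolynomial (Fin 1) K)) := by
  refine ⟨Equiv.refl _, ?_⟩
  simp only [IsLinearlyReducibleFor, Equiv.refl_symm, Equiv.coe_refl, rename_id,
    AlgHom.coe_id, Finset.image_id]
  refine ⟨fun P hP => ?_, LinearReduction.isLinearlyReducibleSeq_zero _⟩
  simp only [Finset.mem_insert, Finset.mem_singleton] at hP
  rcases hP with rfl | rfl
  · exact LinearReduction.isLinearInZero_X_zero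
  · exact LinearReduction.isLinearInZero_one_sub_X_zero

end Literature.NumberTheory.Transcendental
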